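import Summits.QuantumAdvantage.QuantumAdvantage.Theorems.WbwObfuscatedGluedTreesKowPhWalkSemAux

/-!
# `WbwObfuscatedGluedTrees` (stmt-QuantumAdvantage-2340) — line `knowledge-of-walk-split`, STAGE 7 (the PRF hybrid):
# semantics of the layer-C program (registered stub `stub_walkSem`)

The adaptive straight-line program `walkQ Λ` / `walkOut Λ` of `KowPhPrograms` §5 (seven layer-B requests per walk
request, through an arbitrary oracle `O'` that answers every layer-B request `mkReq Λ n body` by the specification
`primSpec μ d T body` of layer B, `μ = Λ.prfParam n`, `d = Λ.depth n`) answers every request EXACTLY as the request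
oracle `reqSpec σ ν` of the ideal-II instance `σ = codeCycle T d`, `ν = codeNaming T d`:

* `1·_` (the lead's private request) / `0 1 _` (the walker's ENTRANCE request): one ENCRYPT request of the label of
  the EXIT, resp. the ENTRANCE, answered by `vname = List.ofFn ∘ ν` (`ofFn_naming`);
* `0 0 q` with `|q| ≠ 2N`: `[]` on both sides; with `|q| = 2N`: request 0 RECOGNISES `q ↾ N` (`unname`); a dishonest
  name makes every later request a dummy and the bit `0` — the bit of the all-invalid answer, since the name names
  no vertex (`walkSem_oracle_none`); an honest name `name v` yields `1·label v`, whose fields drive requests 1–3 (the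
  cycle atom of a leaf: `walkSem_atom`, i.e. the cross positions `cross₁`, `cross₂` of `codeCycle T d`) and the
  neighbour labels (`walkSem_nbrLabels`), encrypted by requests 4–6, insertion-sorted by value (`toolkit_phWalkSemAux`)
  — which is the tree's `gluedTreesOracle σ ν (ν v)` listed as strings (`walkSem_oracle_some`) —, assembled into
  `answerBits σ ν a` and read at bit `val(q ⇂ N) = nameVal b` (`walkSem_bitsToNat_ofFn`): the bit `nbrBit` of
  `bitOracle σ ν q`.

The seven answers are pinned one request at a time (`progAnswers_seven`); the program text is unfolded
definitionally (`walkQ_ff`, `walkOut_ff`).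

[folklore] (objects: ChildsEtAl2003 §2 / §4 Game 1; Goldreich2004FoC2 Constructions 5.3.9 / 5.4.19;
LadnerLynchSelman1975 §3).
-/

set_option linter.dupNamespace false

noncomputable section

namespace Summit.QuantumAdvantage.QuantumAdvantage.Theorems.WbwObfuscatedGluedTrees.KnowledgeOfWalk.PrfHybrid

open Literature.Computability.Complexity Literature.Computability.QuantumComplexity
open Literature.Computability.QuantumComplexity.GluedTrees
open Literature.Computability.Cryptography Literature.Computability.Cryptography.ObfuscatedGluedTrees
open Summit.QuantumAdvantage.QuantumAdvantage.Theorems.WbwObfuscatedGluedTrees.KnowledgeOfWalk.BlackBox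
open Summit.QuantumAdvantage.QuantumAdvantage.Theorems.WbwObfuscatedGluedTrees.KnowledgeOfWalk.RealIdeal
open _root_.Computability

/-! ## §1 Adaptive programs: seven steps -/

section Prog

variable {α : Type}

/-- Seven program steps, from their seven answers. [cite: LadnerLynchSelman1975, §3] -/
private theorem progAnswers_seven (Q : α → List (List Bool) → List Bool) (O : Oracle) (a : α)
    {r0 r1 r2 r3 r4 r5 r6 : List Bool}
    (h0 : O (Q a []) = r0) (h1 : O (Q a [r0]) = r1) (h2 : O (Q a [r0, r1]) = r2)
    (h3 : O (Q a [r0, r1, r2]) = r3) (h4 : O (Q a [r0, r1, r2, r3]) = r4)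
    (h5 : O (Q a [r0, r1, r2, r3, r4]) = r5) (h6 : O (Q a [r0, r1, r2, r3, r4, r5]) = r6) :
    progAnswers Q O a 7 = [r0, r1, r2, r3, r4, r5, r6] := by
  subst h0 h1 h2 h3 h4 h5 h6
  rfl

/-- The first answer of a program is the answer to its first query. [folklore] -/
private theorem getD_zero_progAnswers (Q : α → List (List Bool) → List Bool) (O : Oracle) (a : α) :
    ∀ m, (progAnswers Q O a (m + 1)).getD 0 [] = O (Q a [])
  | 0 => rfl
  | m + 1 => by
    rw [show progAnswers Q O a (m + 1 + 1) =
        progAnswers Q O a (m + 1) ++ [O (Q a (progAnswers Q O a (m + 1)))] from rfl,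
      List.getD_append _ _ _ _ (by simp), getD_zero_progAnswers Q O a m]

end Prog

/-! ## §2 The layer-C program on each kind of request -/

section Cases

variable {Λ : Params} {n : ℕ} {O' : Oracle} {T : CodeSpace (Λ.prfParam n)}

/-- **The lead's private request `1·_`**: one ENCRYPT request of the label of the EXIT, whose answer
`name(EXIT)` is the output. [cite: ChildsEtAl2003, §2] -/
private theorem exit_case
    (hO : ∀ body : List Bool, O' (mkReq Λ n body) = primSpec (Λ.prfParam n) (Λ.depth n) T body)
    (u : List Bool) :
    runProg (walkQ Λ) (walkOut Λ) 7 O' (n, true :: u) =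
      reqSpec (codeCycle T (Λ.depth n)) (codeNaming T (Λ.depth n)) (true :: u) := by
  show (progAnswers (walkQ Λ) O' (n, true :: u) (6 + 1)).getD 0 [] =
    List.ofFn (codeNaming T (Λ.depth n) (GluedTrees.exit (Λ.depth n)))
  rw [getD_zero_progAnswers,
    show walkQ Λ (n, true :: u) [] = mkReq Λ n (false :: false :: mkLabel (Λ.depth n) true 0 0) from rfl, hO,
    codeNaming, ofFn_naming]
  rfl

/-- **The walker's ENTRANCE request `0 1 _`**: one ENCRYPT request of the label of the ENTRANCE.
[cite: ChildsEtAl2003, §2] -/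
private theorem entrance_case
    (hO : ∀ body : List Bool, O' (mkReq Λ n body) = primSpec (Λ.prfParam n) (Λ.depth n) T body)
    (u : List Bool) :
    runProg (walkQ Λ) (walkOut Λ) 7 O' (n, false :: true :: u) =
      reqSpec (codeCycle T (Λ.depth n)) (codeNaming T (Λ.depth n)) (false :: true :: u) := by
  show (progAnswers (walkQ Λ) O' (n, false :: true :: u) (6 + 1)).getD 0 [] =
    List.ofFn (codeNaming T (Λ.depth n) (entrance (Λ.depth n)))
  rw [getD_zero_progAnswers,
    show walkQ Λ (n, false :: true :: u) [] = mkReq Λ n (false :: false :: mkLabel (Λ.depth n) false 0 0)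
      from rfl, hO, codeNaming, ofFn_naming]
  rfl

/-- The layer-C query map on a bit query `0 0 q`, unfolded (definitional). [folklore] -/
private theorem walkQ_ff (Λ : Params) (n : ℕ) (q : List Bool) (as : List (List Bool)) :
    walkQ Λ (n, false :: false :: q) as =
      if q.length = nameLen (Λ.prfParam n) (Λ.depth n) + nameLen (Λ.prfParam n) (Λ.depth n) then
        if as.length = 0 then mkReq Λ n (false :: true :: q.take (nameLen (Λ.prfParam n) (Λ.depth n)))
        else if (as.getD 0 []).headD false = false then mkReq Λ n []
        else if as.length ≤ 3 then
          (if labDepth (Λ.depth n) (as.getD 0 []).tail = Λ.depth n then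
            mkReq Λ n ((prpBodies (Λ.depth n) ((as.getD 0 []).tail.headD false)
              (labIdx (Λ.depth n) (as.getD 0 []).tail) (as.getD 1 [])).getD (as.length - 1) [])
          else mkReq Λ n [])
        else if as.length - 4 <
            (nbrLabels (Λ.depth n) (as.getD 0 []).tail (as.getD 2 []) (as.getD 3 [])).length then
          mkReq Λ n (false :: false ::
            (nbrLabels (Λ.depth n) (as.getD 0 []).tail (as.getD 2 []) (as.getD 3 [])).getD (as.length - 4) [])
        else mkReq Λ n []
      else mkReq Λ n [] :=
  rfl

/-- The layer-C output map on a bit query `0 0 q`, unfolded (definitional). [folklore] -/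
private theorem walkOut_ff (Λ : Params) (n : ℕ) (q : List Bool) (as : List (List Bool)) :
    walkOut Λ (n, false :: false :: q) as =
      if q.length = nameLen (Λ.prfParam n) (Λ.depth n) + nameLen (Λ.prfParam n) (Λ.depth n) then
        if (as.getD 0 []).headD false = false then [false]
        else
          [(fit (ansLen (nameLen (Λ.prfParam n) (Λ.depth n)))
            (bitsOf 2 (sortByVal ((List.range (nbrLabels (Λ.depth n) (as.getD 0 []).tail (as.getD 2 [])
                (as.getD 3 [])).length).map fun t => as.getD (4 + t) [])).length ++
              (sortByVal ((List.range (nbrLabels (Λ.depth n) (as.getD 0 []).tail (as.getD 2 [])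
                (as.getD 3 [])).length).map fun t => as.getD (4 + t) [])).flatten)).getD
            (bitsToNat (q.drop (nameLen (Λ.prfParam n) (Λ.depth n)))) false]
      else [] :=
  rfl

/-- Encrypting the `t`-th neighbour label (a dummy request past the end of the list). [folklore] -/
private theorem enc_getD {μ d : ℕ} (T : CodeSpace μ) (L : List (List Bool)) (t : ℕ) :
    primSpec μ d T (if t < L.length then false :: false :: L.getD t [] else []) =
      (L.map (sivEnc (tabScheme T) μ (tkey 0) (tkey 1))).getD t [] := by
  split_ifs with h
  · rw [List.getD_eq_getElem L [] h, List.getD_eq_getElem (L.map _) [] (by simpa using h), List.getElem_map]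
    rfl
  · rw [List.getD_eq_default _ _ (by simpa using not_lt.1 h)]
    rfl

/-- The names answered to requests `4, 5, 6` (as many as there are neighbour labels, `≤ 3`). [folklore] -/
private theorem names_eq (r0 r1 r2 r3 : List Bool) (L : List (List Bool)) (f : List Bool → List Bool)
    (hL : L.length ≤ 3) :
    ((List.range L.length).map fun t => [r0, r1, r2, r3, (L.map f).getD 0 [], (L.map f).getD 1 [],
      (L.map f).getD 2 []].getD (4 + t) []) = L.map f := by
  refine List.ext_getElem (by simp) fun t h₁ h₂ => ?_
  rw [List.getElem_map, List.getElem_range, ← List.getD_eq_getElem _ [] h₂]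
  rw [List.length_map] at h₂
  have ht : t = 0 ∨ t = 1 ∨ t = 2 := by omega
  rcases ht with rfl | rfl | rfl <;> rfl

/-- **A bit query `0 0 q` with `|q| = 2N`**: recognise the name `q ↾ N` (request 0); for an honest name
`name v`, read the cycle atom of `v` if it is a leaf (requests 1–3), encrypt the labels of its `≤ 3` neighbours
(requests 4–6), sort by value, assemble the answer string and return its bit `val(q ⇂ N)` — which is the bit
`nbrBit` of the instance `(codeCycle T d, codeNaming T d)`; a dishonest name gets the bit `0` of the all-invalid
answer. [cite: ChildsEtAl2003, §2 and §4 Game 1] -/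
private theorem bit_case
    (hO : ∀ body : List Bool, O' (mkReq Λ n body) = primSpec (Λ.prfParam n) (Λ.depth n) T body)
    {q : List Bool} (hq : q.length = nameLen (Λ.prfParam n) (Λ.depth n) + nameLen (Λ.prfParam n) (Λ.depth n))
    {a b : Fin (nameLen (Λ.prfParam n) (Λ.depth n)) → Bool}
    (ha : List.ofFn a = q.take (nameLen (Λ.prfParam n) (Λ.depth n)))
    (hb : List.ofFn b = q.drop (nameLen (Λ.prfParam n) (Λ.depth n))) :
    runProg (walkQ Λ) (walkOut Λ) 7 O' (n, false :: false :: q) =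
      [(answerBits (codeCycle T (Λ.depth n)) (codeNaming T (Λ.depth n)) a).getD (nameVal b) false] := by
  -- request 0 recognises the name `q ↾ N`
  have hA0 : O' (walkQ Λ (n, false :: false :: q) []) =
      ((unname (tabScheme T) (Λ.prfParam n) (tkey 0) (tkey 1) (Λ.depth n)
        (q.take (nameLen (Λ.prfParam n) (Λ.depth n)))).map fun v => true :: label (Λ.depth n) v).getD [] := by
    rw [show walkQ Λ (n, false :: false :: q) [] =
        if q.length = nameLen (Λ.prfParam n) (Λ.depth n) + nameLen (Λ.prfParam n) (Λ.depth n)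
        then mkReq Λ n (false :: true :: q.take (nameLen (Λ.prfParam n) (Λ.depth n))) else mkReq Λ n []
        from rfl, if_pos hq, hO]
    rfl
  rcases hun : unname (tabScheme T) (Λ.prfParam n) (tkey 0) (tkey 1) (Λ.depth n)
      (q.take (nameLen (Λ.prfParam n) (Λ.depth n))) with _ | v
  · -- a dishonest name: every later request is a dummy, the bit is `0`, as in the all-invalid answer
    replace hA0 : O' (walkQ Λ (n, false :: false :: q) []) = [] := by rw [hA0, hun]; rfl
    have hAnil : ∀ rest : List (List Bool), O' (walkQ Λ (n, false :: false :: q) ([] :: rest)) = [] := by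
      intro rest
      rw [show walkQ Λ (n, false :: false :: q) ([] :: rest) =
          if q.length = nameLen (Λ.prfParam n) (Λ.depth n) + nameLen (Λ.prfParam n) (Λ.depth n)
          then mkReq Λ n [] else mkReq Λ n [] from rfl, ite_self, hO]
      rfl
    have hν : ∀ w, codeNaming T (Λ.depth n) w ≠ a := fun w hw =>
      (unname_eq_none_iff _ _ _ _ _ _).1 hun w (by rw [← ha, ← hw]; exact (ofFn_naming _ _ _ _ _ w).symm)
    rw [walkSem_answerBits_getD_of_nil _ _ (walkSem_oracle_none _ _ hν), runProg,
      progAnswers_seven (walkQ Λ) O' (n, false :: false :: q) hA0 (hAnil _) (hAnil _) (hAnil _) (hAnil _)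
        (hAnil _) (hAnil _), walkOut_ff, if_pos hq]
    rfl
  · -- an honest name `q ↾ N = name v`
    replace hA0 : O' (walkQ Λ (n, false :: false :: q) []) = true :: label (Λ.depth n) v := by
      rw [hA0, hun]; rfl
    have hname := (unname_eq_some_iff _ _ _ _ _ _ _).1 hun
    have hνa : naming (tabScheme T) (Λ.prfParam n) (tkey 0) (tkey 1) (Λ.depth n) v = a :=
      List.ofFn_injective (((ofFn_naming _ _ _ _ _ v).trans hname).trans ha.symm)
    have hd1 : 1 ≤ Λ.depth n := Λ.depth_pos n
    obtain ⟨hx1, hx2, hx3⟩ := walkSem_label_fields (d := Λ.depth n) v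
    -- requests 1–3: the cycle atom of a leaf (dummies at an inner vertex)
    obtain ⟨r1, hr1⟩ : ∃ r, r = primSpec (Λ.prfParam n) (Λ.depth n) T
        (if depth v = Λ.depth n then (prpBodies (Λ.depth n) v.1 (idx v) []).getD 0 [] else []) := ⟨_, rfl⟩
    obtain ⟨r2, hr2⟩ : ∃ r, r = primSpec (Λ.prfParam n) (Λ.depth n) T
        (if depth v = Λ.depth n then (prpBodies (Λ.depth n) v.1 (idx v) r1).getD 1 [] else []) := ⟨_, rfl⟩
    obtain ⟨r3, hr3⟩ : ∃ r, r = primSpec (Λ.prfParam n) (Λ.depth n) T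
        (if depth v = Λ.depth n then (prpBodies (Λ.depth n) v.1 (idx v) r1).getD 2 [] else []) := ⟨_, rfl⟩
    have hA1 : O' (walkQ Λ (n, false :: false :: q) [true :: label (Λ.depth n) v]) = r1 := by
      rw [walkQ_ff, if_pos hq, hr1]
      simp only [List.length_cons, List.length_nil, Nat.reduceAdd, Nat.reduceEqDiff, if_false,
        List.getD_cons_zero, List.headD_cons, Bool.true_eq_false, Nat.reduceLeDiff, if_true, List.tail_cons,
        hx1, hx2, hx3, List.getD_cons_succ, List.getD_nil, Nat.reduceSub]
      split_ifs <;> exact hO _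
    have hA2 : O' (walkQ Λ (n, false :: false :: q) [true :: label (Λ.depth n) v, r1]) = r2 := by
      rw [walkQ_ff, if_pos hq, hr2]
      simp only [List.length_cons, List.length_nil, Nat.reduceAdd, Nat.reduceEqDiff, if_false,
        List.getD_cons_zero, List.headD_cons, Bool.true_eq_false, Nat.reduceLeDiff, if_true, List.tail_cons,
        hx1, hx2, hx3, List.getD_cons_succ, Nat.reduceSub]
      split_ifs <;> exact hO _
    have hA3 : O' (walkQ Λ (n, false :: false :: q) [true :: label (Λ.depth n) v, r1, r2]) = r3 := by
      rw [walkQ_ff, if_pos hq, hr3]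
      simp only [List.length_cons, List.length_nil, Nat.reduceAdd, Nat.reduceEqDiff, if_false,
        List.getD_cons_zero, List.headD_cons, Bool.true_eq_false, Nat.reduceLeDiff, if_true, List.tail_cons,
        hx1, hx2, hx3, List.getD_cons_succ, Nat.reduceSub]
      split_ifs <;> exact hO _
    -- the neighbour labels
    have hat : depth v = Λ.depth n →
        bitsToNat r2 = idx (cross₁ (codeCycle T (Λ.depth n)) v) ∧
          bitsToNat r3 = idx (cross₂ (codeCycle T (Λ.depth n)) v) := fun hv =>
      walkSem_atom T (Λ.depth n) hv r1 r2 r3 (by rw [hr1, if_pos hv]) (by rw [hr2, if_pos hv])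
        (by rw [hr3, if_pos hv])
    have hL := walkSem_nbrLabels (codeCycle T (Λ.depth n)) v r2 r3 (fun hv => (hat hv).1) fun hv => (hat hv).2
    have hlen : (((if depth v = 0 then [] else [parentV v]) ++
        (if depth v < Λ.depth n then [childV v false, childV v true]
          else [cross₁ (codeCycle T (Λ.depth n)) v, cross₂ (codeCycle T (Λ.depth n)) v])).map
            (label (Λ.depth n))).length ≤ 3 := by
      rw [List.length_map]; exact walkSem_nbrList_length _ v
    -- requests 4–6: the names of the neighbours
    have hA4 : O' (walkQ Λ (n, false :: false :: q) [true :: label (Λ.depth n) v, r1, r2, r3]) =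
        ((nbrLabels (Λ.depth n) (label (Λ.depth n) v) r2 r3).map
          (sivEnc (tabScheme T) (Λ.prfParam n) (tkey 0) (tkey 1))).getD 0 [] := by
      rw [walkQ_ff, if_pos hq, ← enc_getD T _ 0]
      simp only [List.length_cons, List.length_nil, Nat.reduceAdd, Nat.reduceEqDiff, if_false,
        List.getD_cons_zero, List.headD_cons, Bool.true_eq_false, Nat.reduceLeDiff, List.tail_cons,
        List.getD_cons_succ, Nat.reduceSub]
      split_ifs <;> exact hO _
    have hA5 : O' (walkQ Λ (n, false :: false :: q) [true :: label (Λ.depth n) v, r1, r2, r3,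
        ((nbrLabels (Λ.depth n) (label (Λ.depth n) v) r2 r3).map
          (sivEnc (tabScheme T) (Λ.prfParam n) (tkey 0) (tkey 1))).getD 0 []]) =
        ((nbrLabels (Λ.depth n) (label (Λ.depth n) v) r2 r3).map
          (sivEnc (tabScheme T) (Λ.prfParam n) (tkey 0) (tkey 1))).getD 1 [] := by
      rw [walkQ_ff, if_pos hq, ← enc_getD T _ 1]
      simp only [List.length_cons, List.length_nil, Nat.reduceAdd, Nat.reduceEqDiff, if_false,
        List.getD_cons_zero, List.headD_cons, Bool.true_eq_false, Nat.reduceLeDiff, List.tail_cons,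
        List.getD_cons_succ, Nat.reduceSub]
      split_ifs <;> exact hO _
    have hA6 : O' (walkQ Λ (n, false :: false :: q) [true :: label (Λ.depth n) v, r1, r2, r3,
        ((nbrLabels (Λ.depth n) (label (Λ.depth n) v) r2 r3).map
          (sivEnc (tabScheme T) (Λ.prfParam n) (tkey 0) (tkey 1))).getD 0 [],
        ((nbrLabels (Λ.depth n) (label (Λ.depth n) v) r2 r3).map
          (sivEnc (tabScheme T) (Λ.prfParam n) (tkey 0) (tkey 1))).getD 1 []]) =
        ((nbrLabels (Λ.depth n) (label (Λ.depth n) v) r2 r3).map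
          (sivEnc (tabScheme T) (Λ.prfParam n) (tkey 0) (tkey 1))).getD 2 [] := by
      rw [walkQ_ff, if_pos hq, ← enc_getD T _ 2]
      simp only [List.length_cons, List.length_nil, Nat.reduceAdd, Nat.reduceEqDiff, if_false,
        List.getD_cons_zero, List.headD_cons, Bool.true_eq_false, Nat.reduceLeDiff, List.tail_cons,
        List.getD_cons_succ, Nat.reduceSub]
      split_ifs <;> exact hO _
    -- the output: sort, assemble, read one bit
    rw [runProg, progAnswers_seven (walkQ Λ) O' (n, false :: false :: q) hA0 hA1 hA2 hA3 hA4 hA5 hA6,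
      walkOut_ff, if_pos hq]
    simp only [List.getD_cons_zero, List.headD_cons, Bool.true_eq_false, if_false, List.tail_cons,
      List.getD_cons_succ, hL]
    rw [names_eq _ _ _ _ _ _ hlen, toolkit_phWalkSemAux,
      ← walkSem_oracle_some hd1 (codeCycle T (Λ.depth n)) (tabScheme T) (Λ.prfParam n) (tkey 0) (tkey 1) v,
      List.length_map, hνa, ← hb, walkSem_bitsToNat_ofFn]
    rfl

end Cases

/-! ## §3 The registered stub -/

/-- **Stub (layer C, semantics)**: against every oracle `O'` answering the layer-B requests `mkReq Λ n body` by the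
specification `primSpec μ d T body` of layer B over a table quadruple `T`, the seven-request program
`walkQ Λ` / `walkOut Λ` answers every request `req` exactly as the request oracle `reqSpec` of the ideal-II
instance `(codeCycle T d, codeNaming T d)`: the lead's private request by `name(EXIT)`, the walker's ENTRANCE
request by `name(ENTRANCE)`, a bit query by the bit `nbrBit` of the neighbour circuit's functionality, anything
else by `[]`. [cite: ChildsEtAl2003, §2 and §4 Game 1] -/
theorem stub_walkSem :
    ∀ (Λ : Params) (n : ℕ) (O' : Oracle) (T : CodeSpace (Λ.prfParam n)),
      (∀ body : List Bool, O' (mkReq Λ n body) = primSpec (Λ.prfParam n) (Λ.depth n) T body) →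
      ∀ req : List Bool,
        runProg (walkQ Λ) (walkOut Λ) 7 O' (n, req) =
          reqSpec (codeCycle T (Λ.depth n)) (codeNaming T (Λ.depth n)) req := by
  intro Λ n O' T hO req
  match req with
  | [] => rfl
  | [false] => rfl
  | true :: u => exact exit_case hO u
  | false :: true :: u => exact entrance_case hO u
  | false :: false :: q =>
    show _ = bitOracle (codeCycle T (Λ.depth n)) (codeNaming T (Λ.depth n)) q
    dsimp only [bitOracle]
    by_cases hq : q.length = nameLen (Λ.prfParam n) (Λ.depth n) + nameLen (Λ.prfParam n) (Λ.depth n)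
    · rw [dif_pos hq]
      exact bit_case hO hq (walkSem_ofFn_castAdd hq) (walkSem_ofFn_natAdd hq)
    · rw [dif_neg hq]
      show walkOut Λ (n, false :: false :: q) _ = []
      rw [walkOut_ff, if_neg hq]

end Summit.QuantumAdvantage.QuantumAdvantage.Theorems.WbwObfuscatedGluedTrees.KnowledgeOfWalk.PrfHybrid

end
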